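import Literature.AnabelianGeometry.SemiGraphs.TemperedNestedRestrictionSwap
import Literature.AnabelianGeometry.SemiGraphs.TemperedDecompositionTransport
import Literature.AnabelianGeometry.SemiGraphs.TemperedCuspOmission
import HarnessLib

/-!
# Decomposition subgroups `Π^tp_ℍ ⊆ π₁^temp(𝒢)` are insensitive to cusp omission ([IUTchI] §2 p. 44) — proof-only

Mochizuki, *Inter-universal Teichmüller theory I*, §2 p. 44 l. 30–44: "by pulling back … and then omitting cuspidal
edges one obtains … decomposition groups `Π^tp_ℍ ⊆ Π^tp_𝔾` … well-defined up to conjugation" — the decomposition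
groups of a sub-semi-graph `ℍ ⊆ 𝔾` are read indifferently before or after "omission of some of the cuspidal edges"
[cite: Mochizuki2012, IUTchI §2 p.44] [claim: Mochizuki2012, status: disputed] (nothing of the IUT series is asserted
here); Mochizuki, *Semi-graphs of anabelioids*, Publ. RIMS **42** (2006), §1 p. 13 (omitting open edges), Def. 2.1
p. 24 (`𝒢_ℍ`), Ex. 3.10 p. 44 ("`B^temp(𝒢) ⥲ B^temp(𝒢^c)`") [cite: MochizukiSemiAnbd2006, Ex 3.10 p.44].

abc-iut cell, layer L3, seat abc-iut-L3-d1 gen 12, row «AUTOFCONJ-INDUCES-UPTOTWIST + HHSTAB-DERIVED@FINITE-SPECIAL-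
FIBRE», STAGE 2 (L3-lead δ1 (4)), generic half.  PROOF-ONLY (no definition, no instance, no notation, no `Prop`
fact); inputs BY NAME: abc-iut-w4-d052's `decompSubgroups` / `map_mem_decompSubgroups_of_compat`
(`TemperedDecompositionSubgroups.lean`, `TemperedDecompositionTransport.lean`), the cusp-omission equivalence
`isEquivalence_btempRestrict` (`TemperedCuspOmission.lean`) and gen 12's nested-restriction relabelling brick
(`TemperedNestedRestrictionSwap.lean`: `btempRestrictToSwapEquiv`, `btempRestrictToSwapIso`).

WHAT IS PROVED.
* §1 `SemiGraph.Subgraph.isCuspOmission_restrictTo_of_abuts_mem` — for a cusp omission `A ⊆ 𝔾` (e.g. the maximal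
  subgraph) and a sub-semi-graph `ℍ` containing the vertex of each of its edges outside `A`, `A ∩ ℍ ⊆ ℍ` is a cusp
  omission of `ℍ`; `…_of_isConnected` — automatic for CONNECTED `ℍ` with a vertex (an `A`-cusp of `ℍ` abutting
  outside `ℍ` would be an isolated edge of `ℍ`).
* §2 ★ `ProfiniteSemiGraph.TemperedPiChart.decompSubgroups_eq_transport_restrictTo` — for a chart `c` of `𝒢`, a cusp
  omission `A ⊆ 𝔾` and `ℍ ⊆ 𝔾` with `A ∩ ℍ` a cusp omission of `ℍ`:
  `c.decompSubgroups ℍ = (c.transport (B^temp(𝒢) ≌ B^temp(𝒢|_A))⁻¹).decompSubgroups (ℍ ∩ A)` — the SAME subgroups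
  of the SAME group `π₁^temp(𝒢)`.  Proof: the equivalence `B^temp(𝒢|_ℍ) ≌ B^temp((𝒢|_ℍ)|_{A∩ℍ}) ≌ B^temp((𝒢|_A)|_{ℍ∩A})`
  (cusp omission in `𝒢|_ℍ`, then the relabelling) intertwines the restrictions `(−)|_ℍ` and `(−)|_A ⋙ (−)|_{ℍ∩A}`
  (`btempRestrictToSwapIso`); abc-iut-w4-d052's abstract transport in both directions (the reverse compatibility by
  2-categorical pasting of units/counits); the transported chart reads `(−)|_A` as `B^temp(id)`.

Consumer: `SpecialFibreDecompSubgroupsCuspOmission.lean` (the `hHstab` of [IUTchI] Cor. 2.3 (i) in abc-iut-L5's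
currency `S.chart.decompSubgroups ℍ`).  Nothing here is a claim about print; no side is taken on [IUTchIII] Cor. 3.12;
nothing here asserts that abc is proved or refuted.
-/

noncomputable section

namespace Literature.AnabelianGeometry.SemiGraphs

open CategoryTheory ProfiniteSemiGraph

universe u

/-! ### §1. `A ∩ ℍ ⊆ ℍ` is a cusp omission of `ℍ` -/

namespace SemiGraph.Subgraph

variable {G : SemiGraph.{u}}

/-- For a cusp omission `A ⊆ G` and a sub-semi-graph `ℍ ⊆ G` such that every edge of `ℍ` outside `A` (an open edge
of `G` with exactly one abutting branch) abuts to a vertex OF `ℍ`, the sub-semi-graph `A ∩ ℍ ⊆ ℍ` is a cusp omission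
of `ℍ` ([IUTchI] §2 p. 44 "omitting cuspidal edges" of `ℍ`). [cite: Mochizuki2012, IUTchI §2 p.44] -/
theorem isCuspOmission_restrictTo_of_abuts_mem {A : G.Subgraph} (hA : A.IsCuspOmission) (H : G.Subgraph)
    (hcusp : ∀ (b : G.Branch) (w : G.Vertex), G.edgeOf b ∈ H.edges → G.edgeOf b ∉ A.edges →
      G.abuts b = some w → w ∈ H.verts) :
    (A.restrictTo H).IsCuspOmission where
  verts_eq := Set.eq_univ_of_forall fun v => by
    change v.1 ∈ A.verts
    rw [hA.verts_eq]; trivial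
  existsUnique_abuts e he := by
    have he' : e.1 ∉ A.edges := he
    obtain ⟨b₀, hb₀e, hb₀s, huniq⟩ := hA.existsUnique_abuts e.1 he'
    have hb₀H : G.edgeOf b₀ ∈ H.edges := by rw [hb₀e]; exact e.2
    obtain ⟨w, hw⟩ := Option.isSome_iff_exists.mp hb₀s
    have hwH : w ∈ H.verts := hcusp b₀ w hb₀H (hb₀e ▸ he') hw
    refine ⟨⟨b₀, hb₀H⟩, Subtype.ext hb₀e, ?_, fun b' hb'e hb's => Subtype.ext (huniq b'.1
      (congrArg Subtype.val hb'e) ?_)⟩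
    · rw [(H.abuts_mk_eq_some_iff hb₀H ⟨w, hwH⟩).mpr hw]; rfl
    · obtain ⟨u, hu⟩ := Option.isSome_iff_exists.mp hb's
      rw [(H.abuts_eq_some_iff b' u).mp hu]; rfl

/-- For a cusp omission `A ⊆ G` and a CONNECTED sub-semi-graph `ℍ` with a vertex, `A ∩ ℍ ⊆ ℍ` is a cusp omission of
`ℍ`: an edge of `ℍ` outside `A` whose vertex were not in `ℍ` would be an ISOLATED edge of `ℍ`
(`not_isIsolatedEdge_of_isConnected`). [cite: Mochizuki2012, IUTchI §2 p.44] -/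
theorem isCuspOmission_restrictTo_of_isConnected {A : G.Subgraph} (hA : A.IsCuspOmission) (H : G.Subgraph)
    (hH : H.toSemiGraph.IsConnected) (hHv : H.verts.Nonempty) : (A.restrictTo H).IsCuspOmission := by
  refine isCuspOmission_restrictTo_of_abuts_mem hA H fun b w hbH hbA hbw => ?_
  by_contra hwH
  obtain ⟨v, hv⟩ := hHv
  obtain ⟨b₀, hb₀e, -, huniq⟩ := hA.existsUnique_abuts (G.edgeOf b) hbA
  -- the edge `edgeOf b` of `ℍ` is isolated in `ℍ`: no branch of it abuts to a vertex of `ℍ`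
  refine SemiGraph.not_isIsolatedEdge_of_isConnected hH ⟨⟨v, hv⟩⟩ ⟨G.edgeOf b, hbH⟩ ?_
  have hb : b = b₀ := huniq b rfl (by rw [hbw]; rfl)
  have hempty : H.toSemiGraph.verticialPortion ⟨G.edgeOf b, hbH⟩ = ∅ := by
    refine Set.eq_empty_of_forall_notMem fun b' ⟨hb'e, hb's⟩ => ?_
    obtain ⟨u, hu⟩ := Option.isSome_iff_exists.mp hb's
    have hu' := (H.abuts_eq_some_iff b' u).mp hu
    have hb' : b'.1 = b₀ := huniq b'.1 (congrArg Subtype.val hb'e) (by rw [hu']; rfl)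
    have : u.1 = w := by
      have h1 := hu'
      rw [hb', ← hb, hbw] at h1
      exact (Option.some.inj h1).symm
    exact hwH (this ▸ u.2)
  change (H.toSemiGraph.verticialPortion ⟨G.edgeOf b, hbH⟩).ncard = 0
  rw [hempty, Set.ncard_empty]

end SemiGraph.Subgraph

/-! ### §2. Decomposition subgroups are insensitive to cusp omission -/

namespace ProfiniteSemiGraph

namespace TemperedPiChart

open Literature.AlgebraicGeometry.Frobenioids.QuasiTemperoid.BTempConnected (hom_ext_apply)

/-- `𝟭 ≅ B^temp(id)` on `B^temp(Π)` by identity maps (bookkeeping). [cite: MochizukiSemiAnbd2006, Prop 3.2 p.35] -/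
theorem nonempty_id_iso_res_id (M : Type u) [Group M] [TopologicalSpace M] [IsTopologicalGroup M] :
    Nonempty (𝟭 (BTemp M) ≅ BTemp.res (ContinuousMonoidHom.id M)) :=
  ⟨NatIso.ofComponents (fun _ => BTemp.isoOfEquiv (Equiv.refl _) fun _ _ => rfl)
    fun _ => hom_ext_apply fun _ => rfl⟩

/-- `D.map id ∈ 𝒮 ⇒ D ∈ 𝒮` (bookkeeping: `Subgroup.map_id`, stated once so that it applies through the definitional
identifications of transported charts). [cite: MochizukiSemiAnbd2006, Prop 3.2 p.35] -/
theorem mem_of_map_id_mem {M : Type u} [Group M] {𝒮 : Set (Subgroup M)} {D : Subgroup M}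
    (h : D.map (MonoidHom.id M) ∈ 𝒮) : D ∈ 𝒮 := by
  rwa [Subgroup.map_id] at h

/-- The chart of `𝒢|_A` transported from a chart `c` of `𝒢` along a cusp-omission equivalence
`e : B^temp(𝒢) ≌ B^temp(𝒢|_A)` reads the restriction `(−)|_A` as the IDENTITY of `π₁^temp(𝒢)`:
`c⁻¹ ⋙ (−)|_A ⋙ (c.transport e⁻¹) ≅ B^temp(id)` (the unit of `e`, the counit of `c`).
[cite: MochizukiSemiAnbd2006, Ex 3.10 p.44] -/
theorem nonempty_restrict_transport_iso_res_id {𝒢 : ProfiniteSemiGraph.{u}} (c : TemperedPiChart 𝒢)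
    {A : 𝒢.graph.Subgraph} (hA : A.IsCuspOmission) :
    haveI := isEquivalence_btempRestrict hA
    Nonempty (c.equiv.inverse ⋙ 𝒢.btempRestrict A ⋙
        (c.transport (𝒢.btempRestrict A).asEquivalence.symm).equiv.functor ≅
      BTemp.res (ContinuousMonoidHom.id c.G)) := by
  haveI := isEquivalence_btempRestrict hA
  haveI := c.isTopologicalGroup
  obtain ⟨η⟩ := nonempty_id_iso_res_id c.G
  let e := (𝒢.btempRestrict A).asEquivalence
  -- the transported chart's equivalence is `e⁻¹ ⋙ c` (definitional); work in `B^temp(c.G) ⥤ B^temp(c.G)`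
  change Nonempty ((c.equiv.inverse ⋙ e.functor ⋙ e.inverse ⋙ c.equiv.functor : BTemp c.G ⥤ BTemp c.G) ≅
    BTemp.res (ContinuousMonoidHom.id c.G))
  refine ⟨?_⟩
  calc c.equiv.inverse ⋙ e.functor ⋙ e.inverse ⋙ c.equiv.functor
      ≅ c.equiv.inverse ⋙ (e.functor ⋙ e.inverse) ⋙ c.equiv.functor :=
        Functor.isoWhiskerLeft c.equiv.inverse (Functor.associator _ _ _).symm
    _ ≅ c.equiv.inverse ⋙ 𝟭 (BTempCat 𝒢) ⋙ c.equiv.functor :=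
        Functor.isoWhiskerLeft c.equiv.inverse (Functor.isoWhiskerRight e.unitIso.symm _)
    _ ≅ c.equiv.inverse ⋙ c.equiv.functor := Functor.isoWhiskerLeft c.equiv.inverse (Functor.leftUnitor _)
    _ ≅ 𝟭 (BTemp c.G) := c.equiv.counitIso
    _ ≅ BTemp.res (ContinuousMonoidHom.id c.G) := η

/-- ★ **Decomposition subgroups are insensitive to cusp omission** ([IUTchI] §2 p. 44: `Π^tp_ℍ` read before or after
"omitting cuspidal edges"): for a chart `c` of `𝒢`, a cusp omission `A ⊆ 𝔾` and a sub-semi-graph `ℍ ⊆ 𝔾` with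
`A ∩ ℍ` a cusp omission of `ℍ`, the decomposition subgroups of `ℍ` in `π₁^temp(𝒢) = c.G` COINCIDE with the
decomposition subgroups of `ℍ ∩ A ⊆ 𝒢|_A` for the chart of `𝒢|_A` transported along `B^temp(𝒢) ≌ B^temp(𝒢|_A)`
(the same group).  Via `B^temp(𝒢|_ℍ) ≌ B^temp((𝒢|_ℍ)|_{A∩ℍ}) ≌ B^temp((𝒢|_A)|_{ℍ∩A})` (cusp omission in `𝒢|_ℍ`,
then the relabelling `btempRestrictToSwapEquiv`), which intertwines `(−)|_ℍ` with `(−)|_A ⋙ (−)|_{ℍ∩A}`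
(`btempRestrictToSwapIso`), and abc-iut-w4-d052's abstract transport in both directions.
[cite: Mochizuki2012, IUTchI §2 p.44] -/
theorem decompSubgroups_eq_transport_restrictTo {𝒢 : ProfiniteSemiGraph.{u}} (c : TemperedPiChart 𝒢)
    {A : 𝒢.graph.Subgraph} (hA : A.IsCuspOmission) {H : 𝒢.graph.Subgraph}
    (hHA : (A.restrictTo H).IsCuspOmission) :
    c.decompSubgroups H =
      (c.transport (haveI := isEquivalence_btempRestrict hA
        (𝒢.btempRestrict A).asEquivalence.symm)).decompSubgroups (H.restrictTo A) := by
  haveI := isEquivalence_btempRestrict hA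
  haveI := isEquivalence_btempRestrict (𝒢 := 𝒢.restrict H) (H := A.restrictTo H) hHA
  let e := (𝒢.btempRestrict A).asEquivalence
  let cA : TemperedPiChart (𝒢.restrict A) := c.transport e.symm
  -- the comparison equivalence `B^temp(𝒢|_ℍ) ≌ B^temp((𝒢|_A)|_{ℍ∩A})` and its compatibility with the restrictions
  let e₁ := ((𝒢.restrict H).btempRestrict (A.restrictTo H)).asEquivalence
  let E' : BTempCat (𝒢.restrict H) ≌ BTempCat ((𝒢.restrict A).restrict (H.restrictTo A)) :=
    e₁.trans (𝒢.btempRestrictToSwapEquiv H A)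
  have hKEY : Nonempty (𝒢.btempRestrict H ⋙ E'.functor ≅
      𝒢.btempRestrict A ⋙ (𝒢.restrict A).btempRestrict (H.restrictTo A)) :=
    ⟨𝒢.btempRestrictToSwapIso H A⟩
  have hid : Nonempty (c.equiv.inverse ⋙ 𝒢.btempRestrict A ⋙ cA.equiv.functor ≅
      BTemp.res (ContinuousMonoidHom.id c.G)) :=
    c.nonempty_restrict_transport_iso_res_id hA
  ext D
  constructor
  · -- `⊆`: transport along `P := e⁻¹`, `E := E'⁻¹`
    intro hD
    have hid' : Nonempty (cA.equiv.inverse ⋙ e.inverse ⋙ c.equiv.functor ≅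
        BTemp.res (ContinuousMonoidHom.id c.G)) := hid
    have hKEY' : Nonempty ((𝒢.restrict A).btempRestrict (H.restrictTo A) ⋙ E'.symm.functor ≅
        e.inverse ⋙ 𝒢.btempRestrict H) := by
      obtain ⟨k⟩ := hKEY
      refine ⟨?_⟩
      calc (𝒢.restrict A).btempRestrict (H.restrictTo A) ⋙ E'.inverse
          ≅ (𝟭 _ ⋙ (𝒢.restrict A).btempRestrict (H.restrictTo A)) ⋙ E'.inverse :=
            Functor.isoWhiskerRight (Functor.leftUnitor _).symm _
        _ ≅ ((e.inverse ⋙ e.functor) ⋙ (𝒢.restrict A).btempRestrict (H.restrictTo A)) ⋙ E'.inverse :=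
            Functor.isoWhiskerRight (Functor.isoWhiskerRight e.counitIso.symm _) _
        _ ≅ (e.inverse ⋙ (e.functor ⋙ (𝒢.restrict A).btempRestrict (H.restrictTo A))) ⋙ E'.inverse :=
            Functor.isoWhiskerRight (Functor.associator _ _ _) _
        _ ≅ (e.inverse ⋙ (𝒢.btempRestrict H ⋙ E'.functor)) ⋙ E'.inverse :=
            Functor.isoWhiskerRight (Functor.isoWhiskerLeft e.inverse k.symm) _
        _ ≅ e.inverse ⋙ (𝒢.btempRestrict H ⋙ E'.functor) ⋙ E'.inverse := Functor.associator _ _ _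
        _ ≅ e.inverse ⋙ 𝒢.btempRestrict H ⋙ (E'.functor ⋙ E'.inverse) :=
            Functor.isoWhiskerLeft e.inverse (Functor.associator _ _ _)
        _ ≅ e.inverse ⋙ 𝒢.btempRestrict H ⋙ 𝟭 _ :=
            Functor.isoWhiskerLeft e.inverse (Functor.isoWhiskerLeft _ E'.unitIso.symm)
        _ ≅ e.inverse ⋙ 𝒢.btempRestrict H := Functor.isoWhiskerLeft e.inverse (Functor.rightUnitor _)
    exact mem_of_map_id_mem
      (map_mem_decompSubgroups_of_compat (c𝒢 := c) (cℋ := cA) e.inverse hid' E'.symm hKEY' hD)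
  · -- `⊇`: transport along `P := (−)|_A = e.functor`, `E := E'`
    intro hD
    exact mem_of_map_id_mem
      (map_mem_decompSubgroups_of_compat (c𝒢 := cA) (cℋ := c) (𝒢.btempRestrict A) hid E' hKEY hD)

end TemperedPiChart

end ProfiniteSemiGraph


end Literature.AnabelianGeometry.SemiGraphs

end
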